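import Summits.MatrixMultiplication.MatrixMultiplication.Theorems.LevelOneGL2Designs.Negative.Exponent

/-!
# Negative lemmas for the crux `LevelOneGL2Designs` (stmt-MatrixMultiplication-14080), part L:
the level-`k` test space as a bi-invariant submodule, and the product sets of a triple

Infrastructure file of the cdisprove seat's negative lane (after the sibling crux seat's work file
`Cruxes/LieRankDesigns/Disproof.lean`, which Theorems files may not import).  Vocabulary `GLm`,
`Mat`, `fourierFn`, `RankSupp`, `RankSep` is `LieRankDesigns.Negative.Basics`; `readout` is part A
(`Exponent.lean`).  Contents, for every `GL_m(𝔽_p)` and level `k`: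

* `transl`, `mulEquiv`, `fourierFn_transl`, `rank_transl_arg`, `rankSupp_transl` — the level-`k`
  coefficient tables are stable under `M ↦ a⁻¹ M b⁻¹`, realising `g ↦ f(b g a)`: `F_k` is
  BI-INVARIANT (`rk(aMb) = rk M`).
* `levelMap`, `levelSubmodule`, `mem_levelSubmodule_iff`, `finrank_levelSubmodule_le`,
  `levelSubmodule_left_inv`, `levelSubmodule_right_inv`, `levelSubmodule_bi_inv` — `F_k|_G` as a
  submodule of `ℂ^{GL_m(𝔽_p)}` of dimension `≤ N_k = #{M : rk M ≤ k}`.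
* `sep_clause_of_rankSep` — `RankSep` in the route's `GradedDesignFamily` format with `J = F_k|_G`.
* `quadProducts`, `mem_quadProducts`, `sep_apply_of_mem_quadProducts` — on `P = X⁻¹YY⁻¹Z` a
  separating function of the target `(x₀,z₀)` is the delta function of `x₀⁻¹z₀`.
* `garbage`, `mem_garbage`, `sep_eq_zero_of_mem_garbage` — the non-target products
  `{x⁻¹yy'⁻¹z : y ≠ y'}`, on which every separator vanishes.

No theorem asserts a Theses statement positively.
-/

noncomputable section

open scoped BigOperators

namespace Summit.MatrixMultiplication.MatrixMultiplication.Theorems.LevelOneGL2Designs.Negative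

open Summit.MatrixMultiplication.MatrixMultiplication.Theorems.LieRankDesigns.Negative

variable {p m : ℕ} [Fact p.Prime]

/-! ## Bi-invariance of the level-`k` tables -/

/-- Two-sided translate of a coefficient table: `transl a b c N = c (a⁻¹ N b⁻¹)`. -/
def transl (a b : GLm p m) (c : Mat p m → ℂ) : Mat p m → ℂ :=
  fun N => c (((a⁻¹ : GLm p m) : Mat p m) * N * ((b⁻¹ : GLm p m) : Mat p m))

/-- `M ↦ a M b` as a permutation of `M_m(𝔽_p)`. -/
def mulEquiv (a b : GLm p m) : Mat p m ≃ Mat p m where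
  toFun M := (a : Mat p m) * M * (b : Mat p m)
  invFun N := ((a⁻¹ : GLm p m) : Mat p m) * N * ((b⁻¹ : GLm p m) : Mat p m)
  left_inv M := by
    show ((a⁻¹ : GLm p m) : Mat p m) * ((a : Mat p m) * M * (b : Mat p m)) *
      ((b⁻¹ : GLm p m) : Mat p m) = M
    rw [Matrix.mul_assoc (a : Mat p m), Units.inv_mul_cancel_left, Units.mul_inv_cancel_right]
  right_inv N := by
    show (a : Mat p m) * (((a⁻¹ : GLm p m) : Mat p m) * N * ((b⁻¹ : GLm p m) : Mat p m)) *
      (b : Mat p m) = N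
    rw [Matrix.mul_assoc ((a⁻¹ : GLm p m) : Mat p m), Units.mul_inv_cancel_left,
      Units.inv_mul_cancel_right]

/-- **`F_k` is bi-invariant**: translating the coefficient table realises `g ↦ f(b g a)`. [folklore] -/
theorem fourierFn_transl (a b : GLm p m) (c : Mat p m → ℂ) (g : GLm p m) :
    fourierFn (transl a b c) g = fourierFn c (b * g * a) := by
  unfold fourierFn transl
  rw [← Equiv.sum_comp (mulEquiv a b)]
  refine Finset.sum_congr rfl fun M _ => ?_
  simp only [mulEquiv, Equiv.coe_fn_mk]
  congr 1
  · congr 1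
    rw [Matrix.mul_assoc (a : Mat p m), Units.inv_mul_cancel_left, Units.mul_inv_cancel_right]
  · congr 1
    rw [Units.val_mul, Units.val_mul,
      show (a : Mat p m) * M * (b : Mat p m) * (g : Mat p m)
          = (a : Mat p m) * (M * (b : Mat p m) * (g : Mat p m)) by simp only [Matrix.mul_assoc],
      Matrix.trace_mul_comm]
    simp only [Matrix.mul_assoc]

/-- Two-sided multiplication by units preserves the rank. [folklore] -/
theorem rank_transl_arg (a b : GLm p m) (N : Mat p m) :
    (((a⁻¹ : GLm p m) : Mat p m) * N * ((b⁻¹ : GLm p m) : Mat p m)).rank = N.rank := by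
  have ha : IsUnit (((a⁻¹ : GLm p m) : Mat p m)).det :=
    (Matrix.isUnit_iff_isUnit_det _).mp (Units.isUnit _)
  have hb : IsUnit (((b⁻¹ : GLm p m) : Mat p m)).det :=
    (Matrix.isUnit_iff_isUnit_det _).mp (Units.isUnit _)
  rw [Matrix.rank_mul_eq_left_of_isUnit_det _ _ hb, Matrix.rank_mul_eq_right_of_isUnit_det _ _ ha]

/-- Translation preserves the rank support. [folklore] -/
theorem rankSupp_transl {k : ℕ} (a b : GLm p m) {c : Mat p m → ℂ} (hc : RankSupp k c) :
    RankSupp k (transl a b c) := fun N hN =>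
  hc _ (by rwa [rank_transl_arg])

/-! ## `F_k|_G` as a submodule -/

/-- The coefficient-to-function map on rank-`≤ k` tables. -/
def levelMap (p m k : ℕ) [Fact p.Prime] : ({M : Mat p m // M.rank ≤ k} → ℂ) →ₗ[ℂ] (GLm p m → ℂ) :=
  readout (k := k) fun g : GLm p m => g

/-- `F_k|_G`, the level-`k` test space restricted to `GL_m(𝔽_p)`, as a submodule of `ℂ^G`. -/
def levelSubmodule (p m k : ℕ) [Fact p.Prime] : Submodule ℂ (GLm p m → ℂ) :=
  LinearMap.range (levelMap p m k)

variable {k : ℕ}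

/-- Membership: `f ∈ F_k|_G` iff `f = fourierFn c` for a rank-`≤ k`-supported table `c`. -/
theorem mem_levelSubmodule_iff {f : GLm p m → ℂ} :
    f ∈ levelSubmodule p m k ↔ ∃ c : Mat p m → ℂ, RankSupp k c ∧ ∀ g, f g = fourierFn c g := by
  classical
  constructor
  · rintro ⟨c', rfl⟩
    have hsupp : RankSupp k (fun M : Mat p m => if h : M.rank ≤ k then c' ⟨M, h⟩ else 0) := by
      intro M hM; simp [not_le.mpr hM]
    refine ⟨_, hsupp, fun g => ?_⟩
    rw [fourierFn, sum_eq_sum_rankLE hsupp]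
    simp only [levelMap, readout, LinearMap.coe_mk, AddHom.coe_mk]
    refine Finset.sum_congr rfl fun M _ => ?_
    rw [dif_pos M.2]
  · rintro ⟨c, hc, hfc⟩
    refine ⟨fun M => c M.1, ?_⟩
    funext g
    rw [hfc g]
    exact readout_restrict _ hc g

/-- `fourierFn c ∈ F_k|_G` for a rank-supported table. -/
theorem fourierFn_mem_levelSubmodule {c : Mat p m → ℂ} (hc : RankSupp k c) :
    fourierFn c ∈ levelSubmodule p m k :=
  mem_levelSubmodule_iff.mpr ⟨c, hc, fun _ => rfl⟩

/-- `dim F_k|_G ≤ N_k = #{M : rk M ≤ k}`. -/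
theorem finrank_levelSubmodule_le :
    Module.finrank ℂ (levelSubmodule p m k) ≤ Fintype.card {M : Mat p m // M.rank ≤ k} := by
  have h := LinearMap.finrank_range_le (levelMap p m k)
  rwa [Module.finrank_fintype_fun_eq_card] at h

/-- `F_k|_G` is right-translation invariant. -/
theorem levelSubmodule_right_inv :
    ∀ f ∈ levelSubmodule p m k, ∀ h : GLm p m, (fun g => f (g * h)) ∈ levelSubmodule p m k := by
  intro f hf h
  rw [mem_levelSubmodule_iff] at hf ⊢
  obtain ⟨c, hc, hfc⟩ := hf
  exact ⟨transl h 1 c, rankSupp_transl _ _ hc, fun g => by rw [hfc, fourierFn_transl, one_mul]⟩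

/-- `F_k|_G` is left-translation invariant. -/
theorem levelSubmodule_left_inv :
    ∀ f ∈ levelSubmodule p m k, ∀ h : GLm p m, (fun g => f (h * g)) ∈ levelSubmodule p m k := by
  intro f hf h
  rw [mem_levelSubmodule_iff] at hf ⊢
  obtain ⟨c, hc, hfc⟩ := hf
  exact ⟨transl 1 h c, rankSupp_transl _ _ hc, fun g => by rw [hfc, fourierFn_transl, mul_one]⟩

/-- `F_k|_G` is bi-invariant. -/
theorem levelSubmodule_bi_inv :
    ∀ f ∈ levelSubmodule p m k, ∀ a b : GLm p m,
      (fun g => f (a * g * b)) ∈ levelSubmodule p m k := by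
  intro f hf a b
  have h1 := levelSubmodule_left_inv f hf a
  have h2 := levelSubmodule_right_inv _ h1 b
  simpa [mul_assoc] using h2

variable {X Y Z : Finset (GLm p m)}

/-- The crux's separation clause in the route's `GradedDesignFamily` format, with `J = F_k|_G`. -/
theorem sep_clause_of_rankSep (hsep : RankSep k X Y Z) :
    ∀ x₀ ∈ X, ∀ z₀ ∈ Z, ∃ f ∈ levelSubmodule p m k, ∀ x ∈ X, ∀ y ∈ Y, ∀ y' ∈ Y, ∀ z ∈ Z,
      (x = x₀ ∧ y = y' ∧ z = z₀ → f (x⁻¹ * y * y'⁻¹ * z) = 1) ∧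
      (¬ (x = x₀ ∧ y = y' ∧ z = z₀) → f (x⁻¹ * y * y'⁻¹ * z) = 0) := by
  intro x₀ hx₀ z₀ hz₀
  obtain ⟨c, hc, hsepc⟩ := hsep x₀ hx₀ z₀ hz₀
  refine ⟨fourierFn c, fourierFn_mem_levelSubmodule hc,
    fun x hx y hy y' hy' z hz => ⟨fun h => ?_, fun h => ?_⟩⟩
  · rw [hsepc x hx y hy y' hy' z hz, if_pos h]
  · rw [hsepc x hx y hy y' hy' z hz, if_neg h]

/-! ## Product sets of a triple: all quadruple products, and the garbage -/

/-- The set of all quadruple products `x⁻¹ y y'⁻¹ z`. -/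
def quadProducts (X Y Z : Finset (GLm p m)) : Finset (GLm p m) :=
  ((X ×ˢ Y) ×ˢ (Y ×ˢ Z)).image fun q => q.1.1⁻¹ * q.1.2 * q.2.1⁻¹ * q.2.2

/-- Quadruple products belong to `quadProducts`. -/
theorem mem_quadProducts {x y y' z : GLm p m} (hx : x ∈ X) (hy : y ∈ Y) (hy' : y' ∈ Y)
    (hz : z ∈ Z) : x⁻¹ * y * y'⁻¹ * z ∈ quadProducts X Y Z := by
  classical
  unfold quadProducts
  rw [Finset.mem_image]
  exact ⟨((x, y), (y', z)), by simp [hx, hy, hy', hz], rfl⟩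

/-- On `P = X⁻¹YY⁻¹Z` a separating function of the target `(x₀,z₀)` is the delta function of
`x₀⁻¹z₀` (the TPP consistency is built into the separation clause). -/
theorem sep_apply_of_mem_quadProducts {x₀ z₀ : GLm p m} (hx₀ : x₀ ∈ X) (hz₀ : z₀ ∈ Z)
    {c : Mat p m → ℂ}
    (hsepc : ∀ x ∈ X, ∀ y ∈ Y, ∀ y' ∈ Y, ∀ z ∈ Z,
      fourierFn c (x⁻¹ * y * y'⁻¹ * z) = if x = x₀ ∧ y = y' ∧ z = z₀ then 1 else 0)
    {g : GLm p m} (hg : g ∈ quadProducts X Y Z) :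
    fourierFn c g = if g = x₀⁻¹ * z₀ then 1 else 0 := by
  classical
  unfold quadProducts at hg
  rw [Finset.mem_image] at hg
  obtain ⟨⟨⟨x, y⟩, ⟨y', z⟩⟩, hq, rfl⟩ := hg
  simp only [Finset.mem_product] at hq
  rw [hsepc x hq.1.1 y hq.1.2 y' hq.2.1 z hq.2.2]
  by_cases h : x⁻¹ * y * y'⁻¹ * z = x₀⁻¹ * z₀
  · rw [if_pos h]
    have h1 := hsepc x₀ hx₀ y hq.1.2 y hq.1.2 z₀ hz₀
    rw [if_pos ⟨rfl, rfl, rfl⟩, show x₀⁻¹ * y * y⁻¹ * z₀ = x₀⁻¹ * z₀ by group, ← h,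
      hsepc x hq.1.1 y hq.1.2 y' hq.2.1 z hq.2.2] at h1
    exact h1
  · rw [if_neg h, if_neg]
    rintro ⟨rfl, rfl, rfl⟩
    exact h (by group)

/-- The GARBAGE of a triple: the non-target quadruple products `x⁻¹ y y'⁻¹ z`, `y ≠ y'`. -/
def garbage (X Y Z : Finset (GLm p m)) : Finset (GLm p m) :=
  (((X ×ˢ Y) ×ˢ (Y ×ˢ Z)).filter fun q => q.1.2 ≠ q.2.1).image
    fun q => q.1.1⁻¹ * q.1.2 * q.2.1⁻¹ * q.2.2

/-- Non-target quadruple products belong to the garbage. -/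
theorem mem_garbage {x y y' z : GLm p m} (hx : x ∈ X) (hy : y ∈ Y) (hy' : y' ∈ Y) (hz : z ∈ Z)
    (hne : y ≠ y') : x⁻¹ * y * y'⁻¹ * z ∈ garbage X Y Z := by
  classical
  unfold garbage
  rw [Finset.mem_image]
  exact ⟨((x, y), (y', z)), by simp [hx, hy, hy', hz, hne], rfl⟩

/-- Separators vanish on the garbage. -/
theorem sep_eq_zero_of_mem_garbage {x₀ z₀ : GLm p m} {c : Mat p m → ℂ}
    (hsepc : ∀ x ∈ X, ∀ y ∈ Y, ∀ y' ∈ Y, ∀ z ∈ Z,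
      fourierFn c (x⁻¹ * y * y'⁻¹ * z) = if x = x₀ ∧ y = y' ∧ z = z₀ then 1 else 0)
    {g : GLm p m} (hg : g ∈ garbage X Y Z) : fourierFn c g = 0 := by
  classical
  unfold garbage at hg
  rw [Finset.mem_image] at hg
  obtain ⟨⟨⟨x, y⟩, ⟨y', z⟩⟩, hq, rfl⟩ := hg
  simp only [Finset.mem_filter, Finset.mem_product] at hq
  rw [hsepc x hq.1.1.1 y hq.1.1.2 y' hq.1.2.1 z hq.1.2.2, if_neg]
  rintro ⟨-, h, -⟩
  exact hq.2 h

end Summit.MatrixMultiplication.MatrixMultiplication.Theorems.LevelOneGL2Designs.Negative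

end
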